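import Summits.AtomisticToContinuum.HydrodynamicLimit.Theorems.JParityClosureLocalSecondLawContactCondLaw

/-!
# Stub B′ (`stub_initialMatching`) of the line `contact-asymmetry-information` for the crux `LocalSecondLaw`
(stmt-AtomisticToContinuum-13081) — part 3: velocity moments of the local Gibbs law (uniform integrability input)

The uniform-integrability input of the conditioning step of B′ for the UNBOUNDED coarse observables (momentum `m_r`,
kinetic energy `e_r`): under the inhomogeneous local Gibbs law `P_N` (continuous profiles `a₀, θ₀ > 0`, `u₀`;
`σ ≤ 1/2`), uniformly in `N`, the flow and the label,
* `contactB_lintegral_vel_pow_four_le` — `E‖vᵢ‖⁴ ≤ C(u₀, θ₀)`: the disintegration `lintegral_localGibbsMeasure` (given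
  the positions the velocities are independent Gaussians `N(u₀(xᵢ), θ₀(xᵢ)𝟙)`), the Gaussian fourth moment
  `E‖u + √θ w‖⁴ ≤ 8(‖u‖⁴ + θ² E‖w‖⁴)` (`contactB_integral_norm_pow_four_gauss_le`) and compactness of the torus;
* `contactB_lintegral_velAvg_sq_le` — `E[((N+1)⁻¹∑‖vᵢ‖²)²] ≤ C` (Cauchy–Schwarz `contactB_velAvg_sq_le`);
* `contactB_lintegral_envelope_sq_le` — the envelope `H = (3/(πr³))(½ + ke)` of `‖m_r‖` (`norm_momC_le`) and of `e_r`
  (`contactB_kinC_le_ke`) has `E[H²] ≤ K(r, u₀, θ₀)`.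

References: H. Spohn, *Large Scale Dynamics of Interacting Particles* (1991), Part I §2.3 (local equilibrium states:
Maxwellian velocities given the positions).
-/

noncomputable section

open scoped BigOperators Topology Classical MeasureTheory ENNReal InnerProductSpace
open Filter Set MeasureTheory Function
open Literature.MathematicalPhysics.KineticTheory
open Literature.Analysis.FluidPDE
open Summit.AtomisticToContinuum.HydrodynamicLimit.Theorems.LocalSecondLawNegative
open Summit.AtomisticToContinuum.HydrodynamicLimit.Theorems.LocalSecondLawLedger

namespace Summit.AtomisticToContinuum.HydrodynamicLimit.Theorems.LocalSecondLawContact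

/-- `(x + y)⁴ ≤ 8 (x⁴ + y⁴)` for `x, y ≥ 0` (power-mean). -/
theorem contactB_add_pow_four_le : ∀ {x y : ℝ}, 0 ≤ x → 0 ≤ y → (x + y) ^ 4 ≤ 8 * (x ^ 4 + y ^ 4) := by
  intro x y hx hy
  nlinarith [mul_nonneg (sq_nonneg (x - y)) (by positivity : (0 : ℝ) ≤ 7 * x ^ 2 + 10 * x * y + 7 * y ^ 2)]

/-- Fourth moment of the isotropic Gaussian: `E‖v‖⁴ ≤ 8 (‖u‖⁴ + θ² E_std‖w‖⁴)` for `θ > 0`. -/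
theorem contactB_integral_norm_pow_four_gauss_le :
    ∀ (u : V3) {θ : ℝ}, 0 < θ →
      Integrable (fun v : V3 => ‖v‖ ^ 4) (gaussMeasure u θ) ∧
      ∫ v, ‖v‖ ^ 4 ∂(gaussMeasure u θ) ≤
        8 * (‖u‖ ^ 4 + θ ^ 2 * ∫ w, ‖w‖ ^ 4 ∂(ProbabilityTheory.stdGaussian V3)) := by
  intro u θ hθ
  have hint : Integrable (fun v : V3 => ‖v‖ ^ 4) (gaussMeasure u θ) :=
    (ProbabilityTheory.IsGaussian.memLp_id (gaussMeasure u θ) 4 (by simp)).integrable_norm_pow (by norm_num)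
  refine ⟨hint, ?_⟩
  rw [integral_gaussMeasure u hθ]
  have h4 : Integrable (fun w : V3 => ‖w‖ ^ 4) (ProbabilityTheory.stdGaussian V3) :=
    integrable_norm_pow_four_stdGaussian
  have hpt : ∀ w : V3, ‖u + Real.sqrt θ • w‖ ^ 4 ≤ 8 * (‖u‖ ^ 4 + θ ^ 2 * ‖w‖ ^ 4) := by
    intro w
    have h1 : ‖u + Real.sqrt θ • w‖ ≤ ‖u‖ + Real.sqrt θ * ‖w‖ := by
      calc ‖u + Real.sqrt θ • w‖ ≤ ‖u‖ + ‖Real.sqrt θ • w‖ := norm_add_le _ _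
        _ = ‖u‖ + Real.sqrt θ * ‖w‖ := by
            rw [norm_smul, Real.norm_eq_abs, abs_of_nonneg (Real.sqrt_nonneg θ)]
    have h2 : (‖u‖ + Real.sqrt θ * ‖w‖) ^ 4 ≤ 8 * (‖u‖ ^ 4 + (Real.sqrt θ * ‖w‖) ^ 4) :=
      contactB_add_pow_four_le (norm_nonneg _) (by positivity)
    have hs : Real.sqrt θ ^ 2 = θ := Real.sq_sqrt hθ.le
    have h3 : (Real.sqrt θ * ‖w‖) ^ 4 = θ ^ 2 * ‖w‖ ^ 4 := by
      rw [mul_pow, show Real.sqrt θ ^ 4 = (Real.sqrt θ ^ 2) ^ 2 by ring, hs]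
    rw [h3] at h2
    exact (pow_le_pow_left₀ (norm_nonneg _) h1 4).trans h2
  have hrhs : Integrable (fun w : V3 => 8 * (‖u‖ ^ 4 + θ ^ 2 * ‖w‖ ^ 4)) (ProbabilityTheory.stdGaussian V3) :=
    ((integrable_const _).add (h4.const_mul _)).const_mul _
  have hlhs : Integrable (fun w : V3 => ‖u + Real.sqrt θ • w‖ ^ 4) (ProbabilityTheory.stdGaussian V3) := by
    have h := hint
    rw [gaussMeasure, ← coe_gaussShiftEquiv u hθ] at h
    exact (integrable_map_equiv (gaussShiftEquiv u hθ) (fun v : V3 => ‖v‖ ^ 4)).1 h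
  calc ∫ w, ‖u + Real.sqrt θ • w‖ ^ 4 ∂(ProbabilityTheory.stdGaussian V3)
      ≤ ∫ w, 8 * (‖u‖ ^ 4 + θ ^ 2 * ‖w‖ ^ 4) ∂(ProbabilityTheory.stdGaussian V3) :=
        integral_mono hlhs hrhs hpt
    _ = 8 * (‖u‖ ^ 4 + θ ^ 2 * ∫ w, ‖w‖ ^ 4 ∂(ProbabilityTheory.stdGaussian V3)) := by
        rw [integral_const_mul, integral_add (integrable_const _) (h4.const_mul _), integral_const,
          probReal_univ, one_smul, integral_const_mul]

/-- **Uniform fourth velocity moment under the local Gibbs law** (inhomogeneous profiles): there is `C(u₀, θ₀)` with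
`E_{P_N}‖vᵢ‖⁴ ≤ C` for every `σ ≤ 1/2`, `N`, flow and label `i` (disintegration `lintegral_localGibbsMeasure`:
given the positions the velocities are independent Gaussians `N(u₀(xᵢ), θ₀(xᵢ))`, whose fourth moments are bounded on
the compact torus). -/
theorem contactB_lintegral_vel_pow_four_le :
    ∀ (a₀ θ₀ : T3 → ℝ) (u₀ : T3 → V3), Continuous a₀ → Continuous θ₀ → Continuous u₀ →
      (∀ x, 0 < a₀ x) → (∀ x, 0 < θ₀ x) →
      ∃ C : ℝ, 0 ≤ C ∧ ∀ (σ : ℝ), σ ≤ 1 / 2 → ∀ (N : ℕ) (Φ : Flow σ N) (i : Fin (N + 1)),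
        ∫⁻ z, ENNReal.ofReal (‖(z i).2‖ ^ 4) ∂(localGibbsLaw σ a₀ u₀ θ₀ N Φ) ≤ ENNReal.ofReal C := by
  intro a₀ θ₀ u₀ ha hθ hu ha0 hθ0
  obtain ⟨U, hU0, hU⟩ := exists_forall_abs_le_of_continuous (continuous_norm.comp hu)
  obtain ⟨Θ, hΘ0, hΘ⟩ := exists_forall_abs_le_of_continuous hθ
  set m4 : ℝ := ∫ w, ‖w‖ ^ 4 ∂(ProbabilityTheory.stdGaussian V3)
  have hm4 : 0 ≤ m4 := integral_nonneg fun _ => by positivity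
  set C : ℝ := 8 * (U ^ 4 + Θ ^ 2 * m4)
  have hC : 0 ≤ C := by positivity
  refine ⟨C, hC, fun σ hσ2 N Φ i => ?_⟩
  -- the per-position Gaussian fourth moment is at most `C`
  have hgauss : ∀ x : T3, ∫⁻ v, ENNReal.ofReal (‖v‖ ^ 4) ∂(gaussMeasure (u₀ x) (θ₀ x)) ≤ ENNReal.ofReal C := by
    intro x
    obtain ⟨hint, hle⟩ := contactB_integral_norm_pow_four_gauss_le (u₀ x) (hθ0 x)
    rw [← ofReal_integral_eq_lintegral_ofReal hint (Eventually.of_forall fun v => by positivity)]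
    refine ENNReal.ofReal_le_ofReal (hle.trans ?_)
    have h1 : ‖u₀ x‖ ^ 4 ≤ U ^ 4 := by
      have := hU x
      rw [Function.comp_apply, abs_of_nonneg (norm_nonneg _)] at this
      exact pow_le_pow_left₀ (norm_nonneg _) this 4
    have h2 : θ₀ x ^ 2 ≤ Θ ^ 2 := by
      have := hΘ x
      rw [abs_of_pos (hθ0 x)] at this
      exact pow_le_pow_left₀ (hθ0 x).le this 2
    show 8 * (‖u₀ x‖ ^ 4 + θ₀ x ^ 2 * m4) ≤ 8 * (U ^ 4 + Θ ^ 2 * m4)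
    gcongr
  -- disintegration
  haveI : IsProbabilityMeasure (localGibbsMeasure σ a₀ u₀ θ₀ N) :=
    isProbabilityMeasure_localGibbsMeasure ha hθ hu ha0 hθ0 hσ2 N
  have hG : Measurable fun z : Phase N => ENNReal.ofReal (‖(z i).2‖ ^ 4) :=
    ((measurable_pi_apply i).snd.norm.pow_const 4).ennreal_ofReal
  rw [localGibbsLaw_eq, lintegral_localGibbsMeasure ha hθ hu (fun x => (ha0 x).le) hθ0 σ N hG]
  have hinner : ∀ x : Fin (N + 1) → T3,
      ∫⁻ v, ENNReal.ofReal (‖((zipConfig (x, v)) i).2‖ ^ 4) ∂(velMeasure u₀ θ₀ x) ≤ ENNReal.ofReal C := by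
    intro x
    have h := (measurePreserving_eval (fun j : Fin (N + 1) => gaussMeasure (u₀ (x j)) (θ₀ (x j))) i).lintegral_comp
      ((measurable_norm.pow_const 4).ennreal_ofReal : Measurable fun v : V3 => ENNReal.ofReal (‖v‖ ^ 4))
    simp only [Function.eval] at h
    unfold velMeasure
    simp only [zipConfig_apply]
    rw [h]
    exact hgauss (x i)
  calc ∫⁻ x, ENNReal.ofReal ((canonicalPartition (Torus.geometry (Fin 3)) (hsDiameter σ N) (N + 1)
          (localGibbsProfile a₀ u₀ θ₀))⁻¹ * posWeight a₀ (hsDiameter σ N) (N + 1) x) *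
          ∫⁻ v, ENNReal.ofReal (‖((zipConfig (x, v)) i).2‖ ^ 4) ∂(velMeasure u₀ θ₀ x)
      ≤ ∫⁻ x, ENNReal.ofReal ((canonicalPartition (Torus.geometry (Fin 3)) (hsDiameter σ N) (N + 1)
          (localGibbsProfile a₀ u₀ θ₀))⁻¹ * posWeight a₀ (hsDiameter σ N) (N + 1) x) * ENNReal.ofReal C :=
        lintegral_mono fun x => mul_le_mul_right (hinner x) _
    _ = ENNReal.ofReal C := by
        rw [lintegral_mul_const' _ _ ENNReal.ofReal_ne_top, lintegral_posWeight_eq_one ha hθ hu (fun x => (ha0 x).le) hθ0 σ N,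
          one_mul]

/-- Pointwise Cauchy–Schwarz: `((N+1)⁻¹ ∑ aᵢ)² ≤ (N+1)⁻¹ ∑ aᵢ²` for the squared speeds. -/
theorem contactB_velAvg_sq_le :
    ∀ {N : ℕ} (z : Phase N),
      (((N + 1 : ℕ) : ℝ)⁻¹ * ∑ i, ‖(z i).2‖ ^ 2) ^ 2 ≤ ((N + 1 : ℕ) : ℝ)⁻¹ * ∑ i, ‖(z i).2‖ ^ 4 := by
  intro N z
  have hn : (0 : ℝ) < ((N + 1 : ℕ) : ℝ) := by positivity
  have hcs : (∑ i, ‖(z i).2‖ ^ 2) ^ 2 ≤ ((N + 1 : ℕ) : ℝ) * ∑ i, ‖(z i).2‖ ^ 4 := by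
    have h := sq_sum_le_card_mul_sum_sq (s := (Finset.univ : Finset (Fin (N + 1)))) (f := fun i => ‖(z i).2‖ ^ 2)
    simp only [Finset.card_univ, Fintype.card_fin] at h
    calc (∑ i, ‖(z i).2‖ ^ 2) ^ 2 ≤ ((N + 1 : ℕ) : ℝ) * ∑ i, (‖(z i).2‖ ^ 2) ^ 2 := by exact_mod_cast h
      _ = ((N + 1 : ℕ) : ℝ) * ∑ i, ‖(z i).2‖ ^ 4 := by
          congr 1; exact Finset.sum_congr rfl fun i _ => by ring
  calc (((N + 1 : ℕ) : ℝ)⁻¹ * ∑ i, ‖(z i).2‖ ^ 2) ^ 2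
      = ((N + 1 : ℕ) : ℝ)⁻¹ ^ 2 * (∑ i, ‖(z i).2‖ ^ 2) ^ 2 := by ring
    _ ≤ ((N + 1 : ℕ) : ℝ)⁻¹ ^ 2 * (((N + 1 : ℕ) : ℝ) * ∑ i, ‖(z i).2‖ ^ 4) :=
        mul_le_mul_of_nonneg_left hcs (by positivity)
    _ = ((N + 1 : ℕ) : ℝ)⁻¹ * ∑ i, ‖(z i).2‖ ^ 4 := by field_simp

/-- **Uniform second moment of the mean squared speed** under the local Gibbs law: `E[((N+1)⁻¹∑‖vᵢ‖²)²] ≤ C` with the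
constant of `contactB_lintegral_vel_pow_four_le`. -/
theorem contactB_lintegral_velAvg_sq_le :
    ∀ (a₀ θ₀ : T3 → ℝ) (u₀ : T3 → V3), Continuous a₀ → Continuous θ₀ → Continuous u₀ →
      (∀ x, 0 < a₀ x) → (∀ x, 0 < θ₀ x) →
      ∃ C : ℝ, 0 ≤ C ∧ ∀ (σ : ℝ), σ ≤ 1 / 2 → ∀ (N : ℕ) (Φ : Flow σ N),
        ∫⁻ z, ENNReal.ofReal ((((N + 1 : ℕ) : ℝ)⁻¹ * ∑ i, ‖(z i).2‖ ^ 2) ^ 2) ∂(localGibbsLaw σ a₀ u₀ θ₀ N Φ) ≤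
          ENNReal.ofReal C := by
  intro a₀ θ₀ u₀ ha hθ hu ha0 hθ0
  obtain ⟨C, hC, H4⟩ := contactB_lintegral_vel_pow_four_le a₀ θ₀ u₀ ha hθ hu ha0 hθ0
  refine ⟨C, hC, fun σ hσ2 N Φ => ?_⟩
  set μ := localGibbsLaw σ a₀ u₀ θ₀ N Φ
  have hn : (0 : ℝ) < ((N + 1 : ℕ) : ℝ) := by positivity
  have hmeas : ∀ i : Fin (N + 1), Measurable fun z : Phase N => ENNReal.ofReal (‖(z i).2‖ ^ 4) := fun i =>
    ((measurable_pi_apply i).snd.norm.pow_const 4).ennreal_ofReal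
  have hpt : ∀ z : Phase N, ENNReal.ofReal ((((N + 1 : ℕ) : ℝ)⁻¹ * ∑ i, ‖(z i).2‖ ^ 2) ^ 2) ≤
      ENNReal.ofReal (((N + 1 : ℕ) : ℝ)⁻¹) * ∑ i, ENNReal.ofReal (‖(z i).2‖ ^ 4) := by
    intro z
    rw [← ENNReal.ofReal_sum_of_nonneg (fun i _ => by positivity), ← ENNReal.ofReal_mul (by positivity)]
    exact ENNReal.ofReal_le_ofReal (contactB_velAvg_sq_le z)
  calc ∫⁻ z, ENNReal.ofReal ((((N + 1 : ℕ) : ℝ)⁻¹ * ∑ i, ‖(z i).2‖ ^ 2) ^ 2) ∂μ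
      ≤ ∫⁻ z, ENNReal.ofReal (((N + 1 : ℕ) : ℝ)⁻¹) * ∑ i, ENNReal.ofReal (‖(z i).2‖ ^ 4) ∂μ := lintegral_mono hpt
    _ = ENNReal.ofReal (((N + 1 : ℕ) : ℝ)⁻¹) * ∑ i, ∫⁻ z, ENNReal.ofReal (‖(z i).2‖ ^ 4) ∂μ := by
        rw [lintegral_const_mul' _ _ ENNReal.ofReal_ne_top, lintegral_finsetSum _ fun i _ => hmeas i]
    _ ≤ ENNReal.ofReal (((N + 1 : ℕ) : ℝ)⁻¹) * ∑ _i : Fin (N + 1), ENNReal.ofReal C := by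
        gcongr with i
        exact H4 σ hσ2 N Φ i
    _ = ENNReal.ofReal C := by
        rw [Finset.sum_const, Finset.card_univ, Fintype.card_fin, nsmul_eq_mul, ← ENNReal.ofReal_natCast,
          ← mul_assoc, ← ENNReal.ofReal_mul (by positivity), inv_mul_cancel₀ hn.ne', ENNReal.ofReal_one, one_mul]

/-- `e_r(x) ≤ (3/(πr³))·ke` (cone weights `≤ 3/(πr³)`). -/
theorem contactB_kinC_le_ke : ∀ {N : ℕ} {r : ℝ}, 0 < r → ∀ (w : Phase N) (x : T3),
    kinC r w x ≤ 3 / (Real.pi * r ^ 3) * ke w := by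
  intro N r hr w x
  rw [kinC_eq_sum]
  unfold ke
  have hN : (0 : ℝ) ≤ ((N + 1 : ℕ) : ℝ)⁻¹ := by positivity
  have h : ∑ i, cone r (w i).1 x * (‖(w i).2‖ ^ 2 / 2) ≤ ∑ i, 3 / (Real.pi * r ^ 3) * (‖(w i).2‖ ^ 2 / 2) :=
    Finset.sum_le_sum fun i _ => mul_le_mul_of_nonneg_right (contactB_cone_le_const hr _ _) (by positivity)
  calc ((N + 1 : ℕ) : ℝ)⁻¹ * ∑ i, cone r (w i).1 x * (‖(w i).2‖ ^ 2 / 2)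
      ≤ ((N + 1 : ℕ) : ℝ)⁻¹ * ∑ i, 3 / (Real.pi * r ^ 3) * (‖(w i).2‖ ^ 2 / 2) := mul_le_mul_of_nonneg_left h hN
    _ = 3 / (Real.pi * r ^ 3) * (((N + 1 : ℕ) : ℝ)⁻¹ * ∑ i, ‖(w i).2‖ ^ 2 / 2) := by
        rw [← Finset.mul_sum]; ring

/-- The mean kinetic energy per particle is a measurable function of the configuration. -/
theorem contactB_measurable_ke : ∀ {N : ℕ}, Measurable (ke : Phase N → ℝ) := by
  intro N
  unfold ke
  refine measurable_const.mul (Finset.measurable_sum _ fun i _ => ?_)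
  exact ((measurable_pi_apply i).snd.norm.pow_const 2).div_const 2

/-- `ke = ½ · (N+1)⁻¹ ∑ ‖vᵢ‖²`. -/
theorem contactB_ke_eq : ∀ {N : ℕ} (w : Phase N), ke w = 1 / 2 * (((N + 1 : ℕ) : ℝ)⁻¹ * ∑ i, ‖(w i).2‖ ^ 2) := by
  intro N w
  unfold ke
  rw [Finset.mul_sum, Finset.mul_sum, Finset.mul_sum]
  exact Finset.sum_congr rfl fun i _ => by ring

/-- **Second moment of the envelope** `H = (3/(πr³))(½ + ke)` (which dominates `‖m_r‖`, `norm_momC_le`, and `e_r`,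
`contactB_kinC_le_ke`) under the local Gibbs law, uniformly in `σ ≤ 1/2`, `N`, the flow. -/
theorem contactB_lintegral_envelope_sq_le :
    ∀ (a₀ θ₀ : T3 → ℝ) (u₀ : T3 → V3), Continuous a₀ → Continuous θ₀ → Continuous u₀ →
      (∀ x, 0 < a₀ x) → (∀ x, 0 < θ₀ x) → ∀ {r : ℝ}, 0 < r →
      ∃ K : ℝ, 0 ≤ K ∧ ∀ (σ : ℝ), σ ≤ 1 / 2 → ∀ (N : ℕ) (Φ : Flow σ N),
        ∫⁻ z, ENNReal.ofReal ((3 / (Real.pi * r ^ 3) * (1 / 2 + ke z)) ^ 2) ∂(localGibbsLaw σ a₀ u₀ θ₀ N Φ) ≤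
          ENNReal.ofReal K := by
  intro a₀ θ₀ u₀ ha hθ hu ha0 hθ0 r hr
  obtain ⟨C, hC, HC⟩ := contactB_lintegral_velAvg_sq_le a₀ θ₀ u₀ ha hθ hu ha0 hθ0
  set M : ℝ := 3 / (Real.pi * r ^ 3)
  have hM : 0 ≤ M := by positivity
  refine ⟨M ^ 2 / 2 * (1 + C), by positivity, fun σ hσ2 N Φ => ?_⟩
  set μ := localGibbsLaw σ a₀ u₀ θ₀ N Φ
  set A : Phase N → ℝ := fun z => (((N + 1 : ℕ) : ℝ)⁻¹ * ∑ i, ‖(z i).2‖ ^ 2) ^ 2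
  have hpt : ∀ z : Phase N, ENNReal.ofReal ((M * (1 / 2 + ke z)) ^ 2) ≤
      ENNReal.ofReal (M ^ 2 / 2) * (1 + ENNReal.ofReal (A z)) := by
    intro z
    rw [← ENNReal.ofReal_one, ← ENNReal.ofReal_add zero_le_one (by positivity), ← ENNReal.ofReal_mul (by positivity)]
    refine ENNReal.ofReal_le_ofReal ?_
    have h1 : (1 / 2 + ke z) ^ 2 ≤ 1 / 2 + 2 * ke z ^ 2 := by nlinarith [sq_nonneg (ke z - 1 / 2)]
    have h2 : 2 * ke z ^ 2 = 1 / 2 * A z := by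
      show 2 * ke z ^ 2 = 1 / 2 * (((N + 1 : ℕ) : ℝ)⁻¹ * ∑ i, ‖(z i).2‖ ^ 2) ^ 2
      rw [contactB_ke_eq]; ring
    calc (M * (1 / 2 + ke z)) ^ 2 = M ^ 2 * (1 / 2 + ke z) ^ 2 := by ring
      _ ≤ M ^ 2 * (1 / 2 + 1 / 2 * A z) := by rw [← h2]; exact mul_le_mul_of_nonneg_left h1 (by positivity)
      _ = M ^ 2 / 2 * (1 + A z) := by ring
  have hAm : Measurable fun z : Phase N => ENNReal.ofReal (A z) :=
    ((measurable_const.mul (Finset.measurable_sum _ fun i _ =>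
      (measurable_pi_apply i).snd.norm.pow_const 2)).pow_const 2).ennreal_ofReal
  haveI : IsProbabilityMeasure μ := by
    show IsProbabilityMeasure (localGibbsLaw σ a₀ u₀ θ₀ N Φ)
    exact isProbabilityMeasure_localGibbsLaw ha hθ hu ha0 hθ0 hσ2 N Φ
  calc ∫⁻ z, ENNReal.ofReal ((M * (1 / 2 + ke z)) ^ 2) ∂μ
      ≤ ∫⁻ z, ENNReal.ofReal (M ^ 2 / 2) * (1 + ENNReal.ofReal (A z)) ∂μ := lintegral_mono hpt
    _ = ENNReal.ofReal (M ^ 2 / 2) * (1 + ∫⁻ z, ENNReal.ofReal (A z) ∂μ) := by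
        rw [lintegral_const_mul' _ _ ENNReal.ofReal_ne_top, lintegral_add_left measurable_const, lintegral_const,
          measure_univ, mul_one]
    _ ≤ ENNReal.ofReal (M ^ 2 / 2) * (1 + ENNReal.ofReal C) := by
        gcongr
        exact HC σ hσ2 N Φ
    _ = ENNReal.ofReal (M ^ 2 / 2 * (1 + C)) := by
        rw [← ENNReal.ofReal_one, ← ENNReal.ofReal_add zero_le_one hC, ← ENNReal.ofReal_mul (by positivity)]

end Summit.AtomisticToContinuum.HydrodynamicLimit.Theorems.LocalSecondLawContact

end
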